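import Literature.NumberTheory.NumberFields.BhargavaQuinticSpaceOrbit
import Literature.NumberTheory.NumberFields.BhargavaQuinticSpaceDescent
import Mathlib.LinearAlgebra.FiniteDimensional.Lemmas
import Mathlib.LinearAlgebra.Matrix.ToLin
import HarnessLib

/-!
# Bhargava's quintic space: projective frames and rationality of the frame transformation

Support file for the named fact
`Literature.NumberTheory.NumberFields.BhargavaQuinticSpace.WrightYukie1992_orbit_bijective_etaleQuintic`
(file `BhargavaQuinticSpace.lean`), towards part (b), direction ⟸.  Everything here is PROVED.

Five points of `ℙ³` in general position form a PROJECTIVE FRAME: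

* `projGL g : [v] ↦ [v ᵥ* g]`, the projective transformation of `ℙ³(K)` given by `g ∈ GL₄(K)`
  (`glFourProj k g = projGL (glBaseChange k g)`);
* `FrameData`, `frameData`: representatives `v₀, …, v₄` of five points any four of which are
  independent, with `v₀, …, v₃` a basis and `v₄ = ∑ aⱼ vⱼ`, all `aⱼ ≠ 0`;
* `exists_projGL_apply_eq`: any two such `5`-tuples are related by some `g ∈ GL₄(K)`;
* `exists_coe_eq_smul_of_projGL_apply_eq`: `g` is unique up to a scalar;
* `exists_glFourProj_eq_of_equivariant` (**rationality**): for non-degenerate `A, A' ∈ V(k)`,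
  `char k = 0`, a `Gal(k̄/k)`-EQUIVARIANT bijection `Z_A(k̄) ≃ Z_{A'}(k̄)` is induced by a
  `k`-rational `g ∈ GL₄(k)` (normalise an entry of `g` to `1`; then `σ(g) = g` for all `σ` by
  uniqueness, and Galois-fixed elements of `k̄` lie in `k`, `InfiniteGalois.mem_range_algebraMap_iff_fixed`).

This is the step "`K(A) ≃ K(A')` ⟹ after a `GL₄(k)`-translation `Z_A = Z_{A'}`" of the proof that
isomorphic quintic algebras come from the same rational orbit [Yukie1993, §0.4 Thm (0.4.2), "if"];
cf. [Bhargava2008, §2 pp. 62–63] (the five points determine the `GL₄`-part).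

## References

* M. Bhargava, *Higher composition laws IV*, Ann. of Math. 167 (2008), 53–94, §2. [Bhargava2008]
* A. Yukie, *Shintani Zeta Functions*, LMS LNS 183, CUP (1993), §0.4 Thm (0.4.2). [Yukie1993]
-/

noncomputable section

open Matrix
open scoped LinearAlgebra.Projectivization

namespace Literature.NumberTheory.NumberFields
namespace BhargavaQuinticSpace

universe u

section General

variable {K : Type*} [Field K]

/-! ### Projective transformations of `ℙ³(K)` -/

/-- The projective transformation `[v] ↦ [v ᵥ* g]` of `ℙ³(K)` given by `g ∈ GL₄(K)`. [folklore] -/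
def projGL (g : GL (Fin 4) K) : ℙ K (Fin 4 → K) → ℙ K (Fin 4 → K) :=
  Projectivization.map (Matrix.vecMulLinear (g : Matrix (Fin 4) (Fin 4) K))
    (fun v w hvw => Matrix.vecMul_injective_of_isUnit (Units.isUnit g) (by simpa using hvw))

/-- `projGL g [v] = [v ᵥ* g]`. [folklore] -/
theorem projGL_mk (g : GL (Fin 4) K) (v : Fin 4 → K) (hv : v ≠ 0) :
    projGL g (Projectivization.mk K v hv) =
      Projectivization.mk K (v ᵥ* (g : Matrix (Fin 4) (Fin 4) K))
        (fun h0 => hv (Matrix.vecMul_injective_of_isUnit (Units.isUnit g) (by simpa using h0))) := by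
  simp only [projGL, Projectivization.map_mk]
  rfl

/-- `projGL (g h) = projGL h ∘ projGL g`. [folklore] -/
theorem projGL_mul (g h : GL (Fin 4) K) (p : ℙ K (Fin 4 → K)) :
    projGL (g * h) p = projGL h (projGL g p) := by
  induction p using Projectivization.ind with
  | h v hv => simp only [projGL_mk, Units.val_mul, vecMul_vecMul]

/-- `projGL 1 = id`. [folklore] -/
theorem projGL_one (p : ℙ K (Fin 4 → K)) : projGL 1 p = p := by
  induction p using Projectivization.ind with
  | h v hv => simp only [projGL_mk, Units.val_one, vecMul_one]

/-- `projGL g⁻¹ ∘ projGL g = id`. [folklore] -/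
theorem projGL_inv_apply (g : GL (Fin 4) K) (p : ℙ K (Fin 4 → K)) : projGL g⁻¹ (projGL g p) = p := by
  rw [← projGL_mul, mul_inv_cancel, projGL_one]

/-- `projGL g ∘ projGL g⁻¹ = id`. [folklore] -/
theorem projGL_apply_inv (g : GL (Fin 4) K) (p : ℙ K (Fin 4 → K)) : projGL g (projGL g⁻¹ p) = p := by
  rw [← projGL_mul, inv_mul_cancel, projGL_one]

/-- A scalar multiple of `g` induces the same projective transformation. [folklore] -/
theorem projGL_eq_of_coe_eq_smul {g g' : GL (Fin 4) K} {c : K}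
    (h : (g' : Matrix (Fin 4) (Fin 4) K) = c • (g : Matrix (Fin 4) (Fin 4) K)) (p : ℙ K (Fin 4 → K)) :
    projGL g' p = projGL g p := by
  have hc : c ≠ 0 := by
    intro hc
    rw [hc, zero_smul] at h
    exact (Matrix.GeneralLinearGroup.det_ne_zero g') (by rw [h, det_zero])
  induction p using Projectivization.ind with
  | h v hv =>
    simp only [projGL_mk, h, vecMul_smul]
    rw [Projectivization.mk_eq_mk_iff']
    exact ⟨c, rfl⟩

/-! ### Frames: five points of `ℙ³` in general position -/

/-- Any four of the five points are projectively independent. [folklore] -/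
def IndepFour (p : Fin 5 → ℙ K (Fin 4 → K)) : Prop :=
  ∀ ι : Fin 4 → Fin 5, Function.Injective ι → Projectivization.Independent (p ∘ ι)

/-- Five injectively indexed points of a set in general position satisfy `IndepFour`. [folklore] -/
theorem indepFour_of_inGeneralPosition {S : Set (ℙ K (Fin 4 → K))} (hS : InGeneralPosition S)
    {p : Fin 5 → ℙ K (Fin 4 → K)} (hp : Function.Injective p) (hmem : ∀ i, p i ∈ S) : IndepFour p :=
  fun ι hι => hS (p ∘ ι) (hp.comp hι) fun i => hmem (ι i)

/-- FRAME DATA of five points in general position: representatives `v₀, …, v₄`, a basis `v₀, …, v₃`,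
and the expansion `v₄ = ∑ aⱼ vⱼ` with all `aⱼ ≠ 0`. [folklore] -/
structure FrameData (p : Fin 5 → ℙ K (Fin 4 → K)) where
  /-- representatives -/
  v : Fin 5 → (Fin 4 → K)
  v_ne : ∀ i, v i ≠ 0
  mk_v : ∀ i, Projectivization.mk K (v i) (v_ne i) = p i
  /-- the basis `v₀, …, v₃` -/
  b : Module.Basis (Fin 4) K (Fin 4 → K)
  b_eq : ∀ j : Fin 4, b j = v (Fin.castSucc j)
  /-- coordinates of `v₄` -/
  a : Fin 4 → K
  a_ne : ∀ j, a j ≠ 0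
  v_last : v (Fin.last 4) = ∑ j, a j • v (Fin.castSucc j)

/-- Representatives of independent points are linearly independent. [folklore] -/
theorem linearIndependent_rep_of_indepFour {p : Fin 5 → ℙ K (Fin 4 → K)} (hp : IndepFour p)
    (ι : Fin 4 → Fin 5) (hι : Function.Injective ι) :
    LinearIndependent K fun j => (p (ι j)).rep :=
  Projectivization.independent_iff.mp (hp ι hι)

/-- Frame data exist for five points any four of which are independent. [folklore] -/
def frameData {p : Fin 5 → ℙ K (Fin 4 → K)} (hp : IndepFour p) : FrameData p := by
  classical
  have hli : LinearIndependent K fun j : Fin 4 => (p (Fin.castSucc j)).rep :=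
    linearIndependent_rep_of_indepFour hp Fin.castSucc (Fin.castSucc_injective 4)
  let b : Module.Basis (Fin 4) K (Fin 4 → K) :=
    basisOfLinearIndependentOfCardEqFinrank hli (by simp)
  have hb : ∀ j, b j = (p (Fin.castSucc j)).rep := fun j => by
    simp [b, coe_basisOfLinearIndependentOfCardEqFinrank]
  refine
    { v := fun i => (p i).rep
      v_ne := fun i => (p i).rep_nonzero
      mk_v := fun i => (p i).mk_rep
      b := b
      b_eq := hb
      a := fun j => b.repr (p (Fin.last 4)).rep j
      a_ne := ?_
      v_last := ?_ }
  · -- if `a j = 0`, the four points `p i`, `i ≠ castSucc j`, would be dependent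
    intro j hj
    let ι : Fin 4 → Fin 5 := Fin.succAbove (Fin.castSucc j)
    have hι : Function.Injective ι := Fin.succAbove_right_injective
    have hli' := linearIndependent_rep_of_indepFour hp ι hι
    have hlast : ι 3 = Fin.last 4 := by
      simp only [ι]
      have : Fin.castSucc j ≤ Fin.castSucc (3 : Fin 4) := Fin.castSucc_le_castSucc_iff.mpr (Fin.le_last j)
      rw [Fin.succAbove_of_le_castSucc _ _ this]
      rfl
    have hsum : (p (Fin.last 4)).rep = ∑ j', b.repr (p (Fin.last 4)).rep j' • (p (Fin.castSucc j')).rep := by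
      conv_lhs => rw [← b.sum_repr (p (Fin.last 4)).rep]
      simp only [hb]
    apply hli'.notMem_span_image (s := {3}ᶜ) (x := 3) (by simp)
    rw [hlast, hsum]
    refine Submodule.sum_mem _ fun j' _ => ?_
    by_cases hjj : j' = j
    · rw [hjj, hj, zero_smul]
      exact Submodule.zero_mem _
    · refine Submodule.smul_mem _ _ (Submodule.subset_span ?_)
      have hmem : Fin.castSucc j' ∈ Set.range ι := by
        rw [Fin.range_succAbove]
        simp only [Set.mem_compl_iff, Set.mem_singleton_iff]
        exact fun h => hjj (Fin.castSucc_injective 4 h)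
      obtain ⟨m, hm⟩ := hmem
      refine ⟨m, ?_, by simp [hm]⟩
      simp only [Set.mem_compl_iff, Set.mem_singleton_iff]
      rintro rfl
      rw [hlast] at hm
      exact absurd hm (Fin.castSucc_lt_last j').ne'
  · conv_lhs => rw [← b.sum_repr (p (Fin.last 4)).rep]
    simp only [hb]

namespace FrameData

variable {p : Fin 5 → ℙ K (Fin 4 → K)} (F : FrameData p)

/-- The basis vectors are the first four representatives. [folklore] -/
theorem coe_b : ⇑F.b = fun j => F.v (Fin.castSucc j) := funext F.b_eq

end FrameData

/-! ### Existence: any two frames are related by a projective transformation -/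

/-- **Frames are projectively equivalent.** Given two `5`-tuples of points of `ℙ³(K)` in general
position, some `g ∈ GL₄(K)` maps the first onto the second, point by point. [folklore] -/
theorem exists_projGL_apply_eq {p q : Fin 5 → ℙ K (Fin 4 → K)} (Fp : FrameData p) (Fq : FrameData q) :
    ∃ g : GL (Fin 4) K, ∀ i, projGL g (p i) = q i := by
  classical
  -- the linear map `vⱼ ↦ (a'ⱼ / aⱼ) wⱼ`
  let T : (Fin 4 → K) →ₗ[K] (Fin 4 → K) :=
    Fp.b.constr K fun j => (Fq.a j / Fp.a j) • Fq.v (Fin.castSucc j)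
  have hTb : ∀ j, T (Fp.v (Fin.castSucc j)) = (Fq.a j / Fp.a j) • Fq.v (Fin.castSucc j) := by
    intro j
    rw [← Fp.b_eq, Module.Basis.constr_basis]
  have hTlast : T (Fp.v (Fin.last 4)) = Fq.v (Fin.last 4) := by
    rw [Fp.v_last, map_sum, Fq.v_last]
    refine Finset.sum_congr rfl fun j _ => ?_
    rw [_root_.map_smul, hTb, smul_smul, mul_div_cancel₀ _ (Fp.a_ne j)]
  -- `T` is surjective, hence bijective
  have hTsurj : Function.Surjective T := by
    rw [← LinearMap.range_eq_top, eq_top_iff, ← Fq.b.span_eq, Submodule.span_le]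
    rintro _ ⟨j, rfl⟩
    refine ⟨(Fp.a j / Fq.a j) • Fp.v (Fin.castSucc j), ?_⟩
    rw [_root_.map_smul, hTb, smul_smul, Fq.b_eq,
      div_mul_div_cancel₀ (Fq.a_ne j), div_self (Fp.a_ne j), one_smul]
  have hTinj : Function.Injective T := LinearMap.injective_iff_surjective.mpr hTsurj
  have hTunit : IsUnit T := by
    rw [LinearMap.isUnit_iff_ker_eq_bot]
    exact LinearMap.ker_eq_bot.mpr hTinj
  have hdet : (LinearMap.toMatrix' T)ᵀ.det ≠ 0 := by
    rw [det_transpose]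
    have : IsUnit (LinearMap.toMatrix' T) := hTunit.map LinearMap.toMatrixAlgEquiv'
    exact ((Matrix.isUnit_iff_isUnit_det _).mp this).ne_zero
  refine ⟨Matrix.GeneralLinearGroup.mkOfDetNeZero _ hdet, fun i => ?_⟩
  rw [← Fp.mk_v i, projGL_mk]
  simp only [Matrix.GeneralLinearGroup.val_mkOfDetNeZero, vecMul_transpose, LinearMap.toMatrix'_mulVec]
  induction i using Fin.lastCases with
  | last =>
    simp only [hTlast]
    exact Fq.mk_v _
  | cast j =>
    simp only [hTb]
    rw [← Fq.mk_v (Fin.castSucc j), Projectivization.mk_eq_mk_iff']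
    exact ⟨Fq.a j / Fp.a j, rfl⟩

/-! ### Uniqueness up to scalars -/

/-- **Uniqueness.** Two projective transformations agreeing on five points in general position
differ by a scalar. [folklore] -/
theorem exists_coe_eq_smul_of_projGL_apply_eq {p : Fin 5 → ℙ K (Fin 4 → K)} (Fp : FrameData p)
    (g g' : GL (Fin 4) K) (h : ∀ i, projGL g (p i) = projGL g' (p i)) :
    ∃ c : K, c ≠ 0 ∧ (g' : Matrix (Fin 4) (Fin 4) K) = c • (g : Matrix (Fin 4) (Fin 4) K) := by
  classical
  -- units `c i` with `c i • (v i ᵥ* g') = v i ᵥ* g`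
  have hc : ∀ i, ∃ c : Kˣ, c • (Fp.v i ᵥ* (g' : Matrix (Fin 4) (Fin 4) K)) =
      Fp.v i ᵥ* (g : Matrix (Fin 4) (Fin 4) K) := by
    intro i
    have hi := h i
    rw [← Fp.mk_v i, projGL_mk, projGL_mk, Projectivization.mk_eq_mk_iff] at hi
    exact hi
  choose c hc using hc
  -- the vectors `v j ᵥ* g'`, `j < 4`, form a basis
  let e' : (Fin 4 → K) ≃ₗ[K] (Fin 4 → K) :=
    LinearEquiv.ofBijective (Matrix.vecMulLinear (g' : Matrix (Fin 4) (Fin 4) K))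
      ⟨fun v w hvw => Matrix.vecMul_injective_of_isUnit (Units.isUnit g') (by simpa using hvw),
        (Matrix.vecMul_surjective_iff_isUnit.mpr (Units.isUnit g'))⟩
  let b' : Module.Basis (Fin 4) K (Fin 4 → K) := Fp.b.map e'
  have hb' : ∀ j, b' j = Fp.v (Fin.castSucc j) ᵥ* (g' : Matrix (Fin 4) (Fin 4) K) := by
    intro j
    simp [b', Fp.b_eq, e']
  -- compare the two expansions of `v₄ ᵥ* g = c 4 • (v₄ ᵥ* g')`
  have hexp : ∀ j : Fin 4, (c (Fin.castSucc j) : K) = c (Fin.last 4) := by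
    have e1 : Fp.v (Fin.last 4) ᵥ* (g : Matrix (Fin 4) (Fin 4) K) =
        ∑ j, (Fp.a j * (c (Fin.castSucc j) : K)) • b' j := by
      rw [Fp.v_last, sum_vecMul]
      refine Finset.sum_congr rfl fun j _ => ?_
      rw [smul_vecMul, ← hc (Fin.castSucc j), Units.smul_def, smul_smul, hb']
    have e2 : Fp.v (Fin.last 4) ᵥ* (g : Matrix (Fin 4) (Fin 4) K) =
        ∑ j, ((c (Fin.last 4) : K) * Fp.a j) • b' j := by
      rw [← hc (Fin.last 4), Units.smul_def, Fp.v_last, sum_vecMul, Finset.smul_sum]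
      refine Finset.sum_congr rfl fun j _ => ?_
      rw [smul_vecMul, smul_smul, hb']
    have e3 := congrArg (fun w => (b'.repr w : Fin 4 → K)) (e1.symm.trans e2)
    simp only [b'.repr_sum_self] at e3
    intro j
    have := congrFun e3 j
    have ha := Fp.a_ne j
    field_simp at this
    linear_combination this
  -- hence `g = c 4 • g'`
  set c4 : K := (c (Fin.last 4) : K) with hc4
  have hbasis : ∀ j : Fin 4, Fp.b j ᵥ* (g : Matrix (Fin 4) (Fin 4) K) =
      c4 • (Fp.b j ᵥ* (g' : Matrix (Fin 4) (Fin 4) K)) := by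
    intro j
    rw [Fp.b_eq, ← hc (Fin.castSucc j), Units.smul_def, hexp j]
  have hmat : (g : Matrix (Fin 4) (Fin 4) K) = c4 • (g' : Matrix (Fin 4) (Fin 4) K) := by
    have hlin : Matrix.vecMulLinear (g : Matrix (Fin 4) (Fin 4) K) =
        Matrix.vecMulLinear (c4 • (g' : Matrix (Fin 4) (Fin 4) K)) :=
      Fp.b.ext fun j => by simpa using hbasis j
    apply Matrix.ext_of_single_vecMul
    intro i
    have := LinearMap.congr_fun hlin (Pi.single i 1)
    simpa only [Matrix.vecMulLinear_apply] using this
  refine ⟨c4⁻¹, inv_ne_zero (c (Fin.last 4)).ne_zero, ?_⟩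
  rw [hmat, smul_smul, inv_mul_cancel₀ (c (Fin.last 4)).ne_zero, one_smul]

end General

/-! ### Rationality: a Galois-equivariant projective identification of zero loci is `k`-rational -/

section Rational

variable (k : Type u) [Field k]

/-- `glFourProj g` is `projGL` of the base change of `g`. [folklore] -/
theorem glFourProj_eq_projGL (g : GL (Fin 4) k) : glFourProj k g = projGL (glBaseChange k g) := rfl

/-- Galois compatibility: `σ (projGL g p) = projGL (σ g) (σ p)`. [folklore] -/
theorem galAct_projGL (σ : AlgebraicClosure k ≃ₐ[k] AlgebraicClosure k) (g : GL (Fin 4) (AlgebraicClosure k))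
    (p : ℙ (AlgebraicClosure k) (Fin 4 → AlgebraicClosure k)) :
    galAct k σ (projGL g p) =
      projGL (Matrix.GeneralLinearGroup.map (σ : AlgebraicClosure k →+* AlgebraicClosure k) g)
        (galAct k σ p) := by
  induction p using Projectivization.ind with
  | h v hv =>
    simp only [projGL_mk, galAct_mk]
    congr 1
    funext i
    rw [coe_generalLinearGroup_map]
    exact RingHom.map_vecMul (σ : AlgebraicClosure k →+* AlgebraicClosure k)
      (g : Matrix (Fin 4) (Fin 4) (AlgebraicClosure k)) v i

variable [CharZero k]

/-- **Rationality of the frame transformation.** Let `A, A' ∈ V(k)` be non-degenerate and let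
`β : Z_A(k̄) ≃ Z_{A'}(k̄)` be a `Gal(k̄/k)`-equivariant bijection of their zero loci.  Then `β` is
induced by a `k`-RATIONAL projective transformation `g ∈ GL₄(k)`.  (Frames give `g` over `k̄`,
unique up to scalars; normalising one entry to `1` makes `g` Galois-invariant, hence rational by
infinite Galois theory.) [folklore] -/
theorem exists_glFourProj_eq_of_equivariant {x y : BhargavaQuinticSpace k}
    (hx : IsNondegenerate k x) (hy : IsNondegenerate k y)
    (β : geomZeroLocus k x ≃ geomZeroLocus k y)
    (hβ : ∀ (σ : AlgebraicClosure k ≃ₐ[k] AlgebraicClosure k) (P : geomZeroLocus k x),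
      β (σ • P) = σ • β P) :
    ∃ g : GL (Fin 4) k, ∀ P : geomZeroLocus k x,
      glFourProj k g P = (β P : ℙ (AlgebraicClosure k) (Fin 4 → AlgebraicClosure k)) := by
  classical
  -- enumerate the five points of `Z_A`
  haveI : Fintype (geomZeroLocus k x) := hx.finite_geomZeroLocus.fintype
  have hcard : Fintype.card (geomZeroLocus k x) = 5 := by
    rw [← Set.toFinset_card, ← Set.ncard_eq_toFinset_card', hx.2.1]
  let e : geomZeroLocus k x ≃ Fin 5 := Fintype.equivFinOfCardEq hcard
  let p : Fin 5 → ℙ (AlgebraicClosure k) (Fin 4 → AlgebraicClosure k) := fun i => (e.symm i : _)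
  let q : Fin 5 → ℙ (AlgebraicClosure k) (Fin 4 → AlgebraicClosure k) := fun i => (β (e.symm i) : _)
  have hp : IndepFour p := indepFour_of_inGeneralPosition hx.2.2
    (Subtype.val_injective.comp e.symm.injective) fun i => (e.symm i).2
  have hq : IndepFour q := indepFour_of_inGeneralPosition hy.2.2
    (Subtype.val_injective.comp (β.injective.comp e.symm.injective)) fun i => (β (e.symm i)).2
  obtain ⟨g, hg⟩ := exists_projGL_apply_eq (frameData hp) (frameData hq)
  have hgβ : ∀ P : geomZeroLocus k x,
      projGL g P = (β P : ℙ (AlgebraicClosure k) (Fin 4 → AlgebraicClosure k)) := by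
    intro P
    have := hg (e P)
    simpa [p, q] using this
  -- normalise an entry of `g` to `1`
  obtain ⟨i₀, j₀, hij⟩ : ∃ i j, (g : Matrix (Fin 4) (Fin 4) (AlgebraicClosure k)) i j ≠ 0 := by
    by_contra hall
    push Not at hall
    apply Matrix.GeneralLinearGroup.det_ne_zero g
    have h0 : (g : Matrix (Fin 4) (Fin 4) (AlgebraicClosure k)) = 0 := Matrix.ext fun i j => hall i j
    rw [h0, det_zero]
  set c : AlgebraicClosure k := ((g : Matrix (Fin 4) (Fin 4) (AlgebraicClosure k)) i₀ j₀)⁻¹ with hc_def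
  have hc : c ≠ 0 := inv_ne_zero hij
  have hdet1 : (c • (g : Matrix (Fin 4) (Fin 4) (AlgebraicClosure k))).det ≠ 0 := by
    rw [det_smul]
    exact mul_ne_zero (pow_ne_zero _ hc) (Matrix.GeneralLinearGroup.det_ne_zero g)
  let g₁ : GL (Fin 4) (AlgebraicClosure k) := Matrix.GeneralLinearGroup.mkOfDetNeZero _ hdet1
  have hg₁ : (g₁ : Matrix (Fin 4) (Fin 4) (AlgebraicClosure k)) =
      c • (g : Matrix (Fin 4) (Fin 4) (AlgebraicClosure k)) :=
    Matrix.GeneralLinearGroup.val_mkOfDetNeZero _ _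
  have hg₁β : ∀ P : geomZeroLocus k x,
      projGL g₁ P = (β P : ℙ (AlgebraicClosure k) (Fin 4 → AlgebraicClosure k)) := by
    intro P
    rw [projGL_eq_of_coe_eq_smul hg₁]
    exact hgβ P
  have hentry : (g₁ : Matrix (Fin 4) (Fin 4) (AlgebraicClosure k)) i₀ j₀ = 1 := by
    rw [hg₁, Matrix.smul_apply, smul_eq_mul, hc_def, inv_mul_cancel₀ hij]
  -- `g₁` is Galois invariant
  have hfix : ∀ (σ : AlgebraicClosure k ≃ₐ[k] AlgebraicClosure k) (i j : Fin 4),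
      σ ((g₁ : Matrix (Fin 4) (Fin 4) (AlgebraicClosure k)) i j) =
        (g₁ : Matrix (Fin 4) (Fin 4) (AlgebraicClosure k)) i j := by
    intro σ
    let σg : GL (Fin 4) (AlgebraicClosure k) :=
      Matrix.GeneralLinearGroup.map (σ : AlgebraicClosure k →+* AlgebraicClosure k) g₁
    have hσg : ∀ i, projGL σg (p i) = projGL g₁ (p i) := by
      intro i
      have hP : (p i) = galAct k σ ((σ⁻¹ • e.symm i : geomZeroLocus k x) :
          ℙ (AlgebraicClosure k) (Fin 4 → AlgebraicClosure k)) := by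
        rw [coe_galSmul, ← galAct_mul, mul_inv_cancel, galAct_one]
      rw [hg₁β, hP, ← galAct_projGL, hg₁β, ← coe_galSmul, ← hβ, smul_inv_smul]
    obtain ⟨d, hd, hdeq⟩ := exists_coe_eq_smul_of_projGL_apply_eq (frameData hp) σg g₁ hσg
    -- compare the `(i₀, j₀)` entries: `d = 1`
    have hd1 : d = 1 := by
      have := congrFun (congrFun hdeq i₀) j₀
      rw [hentry, Matrix.smul_apply, smul_eq_mul] at this
      change (1 : AlgebraicClosure k) = d * (Matrix.GeneralLinearGroup.map
        (σ : AlgebraicClosure k →+* AlgebraicClosure k) g₁ : Matrix (Fin 4) (Fin 4) _) i₀ j₀ at this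
      rw [coe_generalLinearGroup_map, Matrix.map_apply, hentry, map_one, mul_one] at this
      exact this.symm
    intro i j
    have := congrFun (congrFun hdeq i) j
    rw [hd1, one_smul] at this
    change (g₁ : Matrix (Fin 4) (Fin 4) (AlgebraicClosure k)) i j =
      (Matrix.GeneralLinearGroup.map (σ : AlgebraicClosure k →+* AlgebraicClosure k) g₁ :
        Matrix (Fin 4) (Fin 4) _) i j at this
    rw [coe_generalLinearGroup_map, Matrix.map_apply] at this
    exact this.symm
  -- descend the entries to `k`
  have hrange : ∀ i j, ∃ a : k, algebraMap k (AlgebraicClosure k) a =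
      (g₁ : Matrix (Fin 4) (Fin 4) (AlgebraicClosure k)) i j := fun i j =>
    (InfiniteGalois.mem_range_algebraMap_iff_fixed _).mpr fun σ => hfix σ i j
  choose g₀ hg₀ using hrange
  have hmap : (Matrix.of g₀).map (algebraMap k (AlgebraicClosure k)) =
      (g₁ : Matrix (Fin 4) (Fin 4) (AlgebraicClosure k)) := by
    ext i j
    exact hg₀ i j
  have hdet₀ : (Matrix.of g₀).det ≠ 0 := by
    intro h0
    apply Matrix.GeneralLinearGroup.det_ne_zero g₁
    have := RingHom.map_det (algebraMap k (AlgebraicClosure k)) (Matrix.of g₀)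
    rw [h0, map_zero] at this
    rw [← hmap]
    exact this.symm
  refine ⟨Matrix.GeneralLinearGroup.mkOfDetNeZero _ hdet₀, fun P => ?_⟩
  rw [glFourProj_eq_projGL, ← hg₁β P]
  have hGL : glBaseChange k (Matrix.GeneralLinearGroup.mkOfDetNeZero _ hdet₀) = g₁ := by
    apply Units.ext
    rw [glBaseChange, coe_generalLinearGroup_map, Matrix.GeneralLinearGroup.val_mkOfDetNeZero, hmap]
  rw [hGL]

end Rational

end BhargavaQuinticSpace
end Literature.NumberTheory.NumberFields
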